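import Literature.Analysis.FluidPDE.JiaSverak2014HolderRepresentative
import HarnessLib

/-!
# Jia–Šverák 2014, local higher regularity: the localised Duhamel formula with truncated data

Analysis/FluidPDE proofs file (theorems only, no new definitions, no new named facts), part of
the proof of the named fact `Literature.Analysis.FluidPDE.jia_sverak_2014_local_higher_regularity`
(`JiaSverak2014LocalRegularity.lean`; H. Jia, V. Šverák, Invent. Math. 196 (2014) =
arXiv:1204.0529, §3 Thm 3.2 and the bootstrap remark after its proof, p. 9: higher spatial
derivatives up to `t = 0` "by bootstrap" from the representation
`u = ∫₀ᵗ e^{Δ(t-s)}[-div(u⊗uη) - ∇(pη)] ds + e^{Δt}(u₀η) + u₃`). Every level of the bootstrap uses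
the tree's localised Duhamel formula from the initial time (`duhamel_representation_datum`,
`JiaSverak2014DuhamelWithDatum.lean`) with a new spatial cut-off; this file packages, once and for
all cut-offs, the data of that formula for a bounded Leray solution near `x₀`, following the
construction of the tree's `holder_representative` (`JiaSverak2014HolderRepresentative.lean`)
verbatim: the zero-extended velocity (made bounded *everywhere* over `B(x₀,7/12)` by a null
modification, so that slice-wise estimates need no exceptional sets), the gauged pressure of
Kang–Miura–Tsai's expansion at `(x₀, 7/24)` and its size in `L¹((0,T_b') × B(x₀,7/24))`
(Calderón–Zygmund in `L²` for the near field, the uniformly local energy for the far field), and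
the seven-term representation of `χ u_c` on `(0,T_b) × ℝ³` with data truncated at `T_b`
(causality of the forward potentials):

* `exists_localised_data` — the statement (module docstring of the theorem).

## References

* H. Jia, V. Šverák, Invent. Math. 196 (2014) = arXiv:1204.0529, §3, proof of Thm. 3.2 (p. 9).
  Bib key `JiaSverak2014`.
* K. Kang, H. Miura, T.-P. Tsai, IMRN 2021 = arXiv:1812.10509, Lemma 3.4. Bib key
  `KangMiuraTsai2020`.
* J. C. Robinson, J. L. Rodrigo, W. Sadowski, *The Three-Dimensional Navier–Stokes Equations*
  (2016), §3.1 (3.1). Bib key `RobinsonRodrigoSadowski2016`.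
-/

noncomputable section

open MeasureTheory TopologicalSpace Set Function Filter Metric
open _root_.Topology
open scoped ENNReal NNReal RealInnerProductSpace Laplacian

namespace Literature.Analysis.FluidPDE

namespace JiaSverak2014

open Literature.Analysis.UnboundedOperators LemarieRieusset2016

set_option maxHeartbeats 20000000 in
/-- **The localised Duhamel formula of a bounded Leray solution, with data truncated in time.**
For `K_b ≥ 0` and `α_u` there is `Pp` such that: for every local Leray solution `(u, p)` on
`(0,T') × ℝ³` (measurable datum `u₀`), times `0 < T_b < T_b' ≤ T' `, `T_b' ≤ 1`, with
`|u| ≤ K_b` a.e. on `(0,T_b') × B(x₀, 7/12)` and uniformly local energy `≤ α_u`, there are a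
measurable velocity `us` (`= u` a.e. on the slab `(0,T_b') × ℝ³`, `0` off it, `|us| ≤ K_b`
*everywhere* over `B(x₀,7/12)`, locally integrable with its square) and pressures `ps`, `pb`
(`ps` the zero-extended gauged pressure `p - c_{x₀}(t)` of Kang–Miura–Tsai's expansion at
`(x₀, 7/24)`, locally integrable; `pb` measurable, `= ps` over `B(x₀, 7/24)`, with
`∫∫_{(0,T_b')×B(x₀,7/24)} |pb| ≤ Pp`) such that for every smooth cut-off `χ` supported in
`B̄(x₀, 7/25)` and every direction `c`, a.e. on `(0,T_b) × ℝ³`,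

  `χ u_c = W₊⊛D₁ + Σᵢ(-Re σᵢ(D)W₊⊛D₂ᵢ) + Σᵢ W₊⊛D₃ᵢ + Σᵢ(-Re σᵢ(D)W₊⊛D₄ᵢ) + W₊⊛D₅ - Re σ_c(D)W₊⊛D₆
        + e^{tΔ}(χu₀)_c`,

with the data, truncated at `T_b`: `D₁ = 1_{s<T_b}(Δχ)us_c`, `D₂ᵢ = 1_{s<T_b} 2∂ᵢχ us_c`,
`D₃ᵢ = 1_{s<T_b} ∂ᵢχ usᵢus_c`, `D₄ᵢ = 1_{s<T_b} χ usᵢus_c`, `D₅ = 1_{s<T_b} ∂_cχ pb`, `D₆ = 1_{s<T_b} χ pb`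
(the tree's `duhamel_representation_datum` for the cut-off `ζ(t)χ(x)` with a time plateau `ζ`,
`ζ = 1` on `[0, T_b]`, and causality of the forward potentials, as in the tree's
`holder_representative`, whose construction is followed verbatim).
[cite: JiaSverak2014, §3 proof of Thm. 3.2 (arXiv p. 9)] -/
theorem exists_localised_data {Kb : ℝ} (hKb : 0 ≤ Kb) (αu : ℝ≥0) :
    ∃ Pp : ℝ, 0 ≤ Pp ∧ ∀ {T' : ℝ} {x₀ : EuclideanSpace ℝ (Fin 3)}
      {u₀ : (EuclideanSpace ℝ (Fin 3)) → (EuclideanSpace ℝ (Fin 3))}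
      {u : ℝ → (EuclideanSpace ℝ (Fin 3)) → (EuclideanSpace ℝ (Fin 3))} {p : ℝ → (EuclideanSpace ℝ (Fin 3)) → ℝ}
      {Tb Tb' M : ℝ},
      AEStronglyMeasurable u₀ volume → IsLocalLeraySolutionOn T' 1 u₀ u p →
      0 < Tb → Tb < Tb' → Tb' ≤ T' → Tb' ≤ 1 → (∀ x ∈ closedBall x₀ (7 / 25), ‖u₀ x‖ ≤ M) →
      (∀ᵐ z ∂(volume.restrict (Ioo 0 Tb' ×ˢ ball x₀ (7 / 12))), ‖u z.1 z.2‖ ≤ Kb) →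
      (∀ᵐ t ∂(volume.restrict (Ioo 0 T')), ∀ z : EuclideanSpace ℝ (Fin 3), ∫⁻ x in ball z 1, ‖u t x‖ₑ ^ 2 ≤ αu) →
      ∃ (us : ℝ × EuclideanSpace ℝ (Fin 3) → EuclideanSpace ℝ (Fin 3)) (ps pb : ℝ × EuclideanSpace ℝ (Fin 3) → ℝ),
        Measurable us ∧ Measurable pb ∧
        (∀ᵐ z ∂(volume : Measure (ℝ × EuclideanSpace ℝ (Fin 3))),
          z ∈ Ioo 0 Tb' ×ˢ (univ : Set (EuclideanSpace ℝ (Fin 3))) → us z = u z.1 z.2) ∧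
        (∀ z, z ∉ Ioo 0 Tb' ×ˢ (univ : Set (EuclideanSpace ℝ (Fin 3))) → us z = 0) ∧
        (∀ z : ℝ × EuclideanSpace ℝ (Fin 3), z.2 ∈ ball x₀ (7 / 12) → ‖us z‖ ≤ Kb) ∧
        LocallyIntegrable us volume ∧ LocallyIntegrable (fun z => ‖us z‖ ^ 2) volume ∧
        (∀ z, z ∉ Ioo 0 Tb' ×ˢ (univ : Set (EuclideanSpace ℝ (Fin 3))) → ps z = 0) ∧
        LocallyIntegrable ps volume ∧
        (∀ z : ℝ × EuclideanSpace ℝ (Fin 3), z.2 ∈ ball x₀ (7 / 24) → ps z = pb z) ∧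
        (∀ z, z ∉ Ioo 0 Tb' ×ˢ (univ : Set (EuclideanSpace ℝ (Fin 3))) → pb z = 0) ∧
        IntegrableOn pb (Ioo 0 Tb' ×ˢ ball x₀ (7 / 24)) volume ∧
        (∫ z in Ioo 0 Tb' ×ˢ ball x₀ (7 / 24), ‖pb z‖ ≤ Pp) ∧
        ∀ {χ : (EuclideanSpace ℝ (Fin 3)) → ℝ}, ContDiff ℝ (⊤ : ℕ∞) χ →
          tsupport χ ⊆ closedBall x₀ (7 / 25) → ∀ c : EuclideanSpace ℝ (Fin 3),
          ∀ᵐ z ∂(volume.restrict (Ioo 0 Tb ×ˢ (univ : Set (EuclideanSpace ℝ (Fin 3))))),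
            χ z.2 * ⟪u z.1 z.2, c⟫ =
              heatPotential 1 (fun w : ℝ × EuclideanSpace ℝ (Fin 3) =>
                  if w.1 < Tb then (Δ χ) w.2 * ⟪us w, c⟫ else 0) z
              + ∑ i, (-(multiplierHeatPotential 1 (derivSymbol (EuclideanSpace.basisFun (Fin 3) ℝ i))
                  (fun w : ℝ × EuclideanSpace ℝ (Fin 3) =>
                    if w.1 < Tb then (2 * fderiv ℝ χ w.2 (EuclideanSpace.basisFun (Fin 3) ℝ i)) * ⟪us w, c⟫ else 0) z).re)
              + ∑ i, heatPotential 1 (fun w : ℝ × EuclideanSpace ℝ (Fin 3) =>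
                  if w.1 < Tb then fderiv ℝ χ w.2 (EuclideanSpace.basisFun (Fin 3) ℝ i) *
                    (⟪us w, EuclideanSpace.basisFun (Fin 3) ℝ i⟫ * ⟪us w, c⟫) else 0) z
              + ∑ i, (-(multiplierHeatPotential 1 (derivSymbol (EuclideanSpace.basisFun (Fin 3) ℝ i))
                  (fun w : ℝ × EuclideanSpace ℝ (Fin 3) =>
                    if w.1 < Tb then χ w.2 * (⟪us w, EuclideanSpace.basisFun (Fin 3) ℝ i⟫ * ⟪us w, c⟫) else 0) z).re)
              + heatPotential 1 (fun w : ℝ × EuclideanSpace ℝ (Fin 3) =>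
                  if w.1 < Tb then fderiv ℝ χ w.2 c * pb w else 0) z
              + (-(multiplierHeatPotential 1 (derivSymbol c)
                  (fun w : ℝ × EuclideanSpace ℝ (Fin 3) => if w.1 < Tb then χ w.2 * pb w else 0) z).re)
              + heatExtension (fun y => χ y * ⟪u₀ y, c⟫) z.1 z.2 := by
  classical
  set b : OrthonormalBasis (Fin 3) ℝ (EuclideanSpace ℝ (Fin 3)) := EuclideanSpace.basisFun (Fin 3) ℝ with hb_def
  have hb1 : ∀ i, ‖b i‖ = 1 := fun i => b.orthonormal.1 i
  -- the Calderón–Zygmund constant at `q = 2` and the far-field constant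
  obtain ⟨Cq, hCq⟩ := exists_eLpNorm_localPressureNear_le_of_bound (q := 2) (by norm_num) (by norm_num)
  obtain ⟨Ffar, hFfart, hFfar⟩ := exists_enorm_localPressureFar_le_of_uloc (r := (7 / 24 : ℝ)) (by norm_num) (by norm_num)
  set Vq : ℝ≥0∞ := volume (ball (0 : EuclideanSpace ℝ (Fin 3)) (7 / 12)) with hVq
  have hVqt : Vq ≠ ⊤ := measure_ball_lt_top.ne
  set Vρ : ℝ≥0∞ := volume (ball (0 : EuclideanSpace ℝ (Fin 3)) (7 / 24)) with hVρ
  have hVρt : Vρ ≠ ⊤ := measure_ball_lt_top.ne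
  set Pn : ℝ≥0∞ := (Cq : ℝ≥0∞) * (ENNReal.ofReal (Kb ^ 2) * Vq ^ (1 / (2 : ℝ≥0∞).toReal)) with hPn
  have hPnt : Pn ≠ ⊤ := by
    simp only [hPn]
    exact ENNReal.mul_ne_top ENNReal.coe_ne_top (ENNReal.mul_ne_top ENNReal.ofReal_ne_top
      (ENNReal.rpow_ne_top_of_nonneg (by positivity) hVqt))
  have hFbt : Ffar * (αu : ℝ≥0∞) ≠ ⊤ := ENNReal.mul_ne_top hFfart ENNReal.coe_ne_top
  -- the `L¹` bound of the pressure on the cylinder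
  set PpE : ℝ≥0∞ := Pn * Vρ ^ (1 - 1 / (2 : ℝ≥0∞).toReal) + Ffar * (αu : ℝ≥0∞) * Vρ with hPpE
  have hPpEt : PpE ≠ ⊤ := by
    simp only [hPpE]
    exact ENNReal.add_ne_top.2 ⟨ENNReal.mul_ne_top hPnt (ENNReal.rpow_ne_top_of_nonneg (by norm_num) hVρt),
      ENNReal.mul_ne_top hFbt hVρt⟩
  refine ⟨PpE.toReal, ENNReal.toReal_nonneg, ?_⟩
  intro T' x₀ u₀ u p Tb Tb' M hm₀ hu hTb hTbTb' hTb'T' hTb1 hu₀M hbd hαu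
  have hTb' : 0 < Tb' := hTb.trans hTbTb'
  have hT' : 0 < T' := hTb'.trans_le hTb'T'
  /- ## the slab, the gauge and the weak form -/
  set S : Set (ℝ × EuclideanSpace ℝ (Fin 3)) := Ioo 0 Tb' ×ˢ (univ : Set (EuclideanSpace ℝ (Fin 3))) with hS
  have hSm : MeasurableSet S := measurableSet_Ioo.prod MeasurableSet.univ
  set S' : Set (ℝ × EuclideanSpace ℝ (Fin 3)) := Ioo 0 T' ×ˢ (univ : Set (EuclideanSpace ℝ (Fin 3))) with hS'
  have hS'm : MeasurableSet S' := measurableSet_Ioo.prod MeasurableSet.univ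
  have hSS' : S ⊆ S' := Set.prod_mono (Ioo_subset_Ioo_right hTb'T') Subset.rfl
  obtain ⟨cg, hcg, hdec⟩ := hu.exists_pressure_decomposition x₀ (r := (7 / 24 : ℝ)) (by norm_num)
  have hweak : ∀ ψ : ℝ → (EuclideanSpace ℝ (Fin 3)) → (EuclideanSpace ℝ (Fin 3)),
      IsSpaceTimeTestOn (slab (EuclideanSpace ℝ (Fin 3)) (Iio Tb') isOpen_Iio) ψ →
      (∫ t in Ioo 0 Tb', ∫ x, (⟪u t x, timeDeriv ψ t x⟫ + ⟪u t x, convect (u t) (ψ t) x⟫ +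
          1 * ⟪u t x, Δ (ψ t) x⟫ + (fun t x => p t x - cg t) t x * VectorCalculus.divergence (ψ t) x)) +
        ∫ x, ⟪u₀ x, ψ 0 x⟫ = 0 := fun ψ hψ =>
    hu.weakIdentity_datum_gauge hm₀ hTb' hTb'T' hcg hψ
  /- ## the modified velocity -/
  have hmeasS' : AEStronglyMeasurable (uncurry u) (volume.restrict S') := hu.aestronglyMeasurable
  set uM : ℝ × EuclideanSpace ℝ (Fin 3) → EuclideanSpace ℝ (Fin 3) := hmeasS'.mk (uncurry u) with huM
  have huMm : Measurable uM := hmeasS'.stronglyMeasurable_mk.measurable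
  have huMae : ∀ᵐ z ∂(volume : Measure (ℝ × EuclideanSpace ℝ (Fin 3))), z ∈ S' → uncurry u z = uM z :=
    (ae_restrict_iff' hS'm).1 hmeasS'.ae_eq_mk
  -- first version: the indicator of the slab
  set us₀ : ℝ × EuclideanSpace ℝ (Fin 3) → EuclideanSpace ℝ (Fin 3) := S.indicator uM with hus₀_def
  have hus₀m : Measurable us₀ := huMm.indicator hSm
  have hus₀ : ∀ᵐ z ∂(volume : Measure (ℝ × EuclideanSpace ℝ (Fin 3))), z ∈ S → us₀ z = u z.1 z.2 := by
    filter_upwards [huMae] with z hz hzS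
    rw [hus₀_def, indicator_of_mem hzS, ← hz (hSS' hzS)]; rfl
  have hus₀0 : ∀ z, z ∉ S → us₀ z = 0 := fun z hz => indicator_of_notMem hz _
  -- the velocity bound transferred to `us₀`, a.e.
  have hus₀b : ∀ᵐ z ∂(volume : Measure (ℝ × EuclideanSpace ℝ (Fin 3))),
      z.2 ∈ ball x₀ (7 / 12) → ‖us₀ z‖ ≤ Kb := by
    have h1 : ∀ᵐ z ∂(volume : Measure (ℝ × EuclideanSpace ℝ (Fin 3))), z ∈ Ioo 0 Tb' ×ˢ ball x₀ (7 / 12) → ‖u z.1 z.2‖ ≤ Kb :=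
      (ae_restrict_iff' (measurableSet_Ioo.prod measurableSet_ball)).1 hbd
    filter_upwards [h1, hus₀] with z hz hzu hzB
    by_cases hzS : z ∈ S
    · rw [hzu hzS]; exact hz ⟨hzS.1, hzB⟩
    · rw [hus₀0 z hzS, norm_zero]; exact hKb
  -- second version: bounded everywhere over the ball
  set good : Set (ℝ × EuclideanSpace ℝ (Fin 3)) := {z | z.2 ∈ ball x₀ (7 / 12) → ‖us₀ z‖ ≤ Kb} with hgood
  have hgoodm : MeasurableSet good := by
    have h1 : MeasurableSet {z : ℝ × EuclideanSpace ℝ (Fin 3) | z.2 ∈ ball x₀ (7 / 12)} := measurable_snd measurableSet_ball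
    have h2 : MeasurableSet {z : ℝ × EuclideanSpace ℝ (Fin 3) | ‖us₀ z‖ ≤ Kb} :=
      measurableSet_le hus₀m.norm measurable_const
    have : good = {z : ℝ × EuclideanSpace ℝ (Fin 3) | z.2 ∈ ball x₀ (7 / 12)}ᶜ ∪ {z | ‖us₀ z‖ ≤ Kb} := by
      ext z; simp only [hgood, mem_setOf_eq, mem_union, mem_compl_iff, imp_iff_not_or]
    rw [this]; exact h1.compl.union h2
  set us : ℝ × EuclideanSpace ℝ (Fin 3) → EuclideanSpace ℝ (Fin 3) := good.indicator us₀ with hus_def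
  have husm : Measurable us := hus₀m.indicator hgoodm
  have hgood_ae : ∀ᵐ z ∂(volume : Measure (ℝ × EuclideanSpace ℝ (Fin 3))), z ∈ good := by
    filter_upwards [hus₀b] with z hz; exact hz
  have hus_us₀ : ∀ᵐ z ∂(volume : Measure (ℝ × EuclideanSpace ℝ (Fin 3))), us z = us₀ z := by
    filter_upwards [hgood_ae] with z hz; rw [hus_def, indicator_of_mem hz]
  have hus : ∀ᵐ z ∂(volume : Measure (ℝ × EuclideanSpace ℝ (Fin 3))), z ∈ S → us z = u z.1 z.2 := by
    filter_upwards [hus_us₀, hus₀] with z h1 h2 hzS; rw [h1, h2 hzS]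
  have hus0 : ∀ z, z ∉ S → us z = 0 := fun z hz => by
    by_cases hg : z ∈ good
    · rw [hus_def, indicator_of_mem hg, hus₀0 z hz]
    · rw [hus_def, indicator_of_notMem hg]
  have husb : ∀ z : ℝ × EuclideanSpace ℝ (Fin 3), z.2 ∈ ball x₀ (7 / 12) → ‖us z‖ ≤ Kb := by
    intro z hzB
    by_cases hg : z ∈ good
    · rw [hus_def, indicator_of_mem hg]; exact hg hzB
    · rw [hus_def, indicator_of_notMem hg, norm_zero]; exact hKb
  -- integrability on finite cylinders
  have hu'' : IsLocalLeraySolutionOn Tb' 1 u₀ u p := hu.mono hTb'T'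
  have hcyl : ∀ K : Set (EuclideanSpace ℝ (Fin 3)), IsCompact K →
      IntegrableOn uM (Ioo 0 Tb' ×ˢ K) volume ∧ IntegrableOn (fun z => ‖uM z‖ ^ 2) (Ioo 0 Tb' ×ˢ K) volume := by
    intro K hK
    obtain ⟨h1, h2⟩ := integrableOn_cylinder_of_lintegral_sq_slab hu''.aestronglyMeasurable (fun K hK => hu''.sqIntegrable K hK) hK
    have hae : ∀ᵐ z ∂(volume.restrict (Ioo 0 Tb' ×ˢ K)), uncurry u z = uM z := by
      rw [ae_restrict_iff' (measurableSet_Ioo.prod hK.measurableSet)]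
      filter_upwards [huMae] with z hz hzK
      exact hz (hSS' ⟨hzK.1, mem_univ _⟩)
    exact ⟨h1.congr_fun_ae hae, h2.congr_fun_ae (hae.mono fun z hz => by simp only [hz])⟩
  have hus₀i : LocallyIntegrable us₀ volume := by
    rw [locallyIntegrable_iff]
    intro K hK
    rw [hus₀_def, integrableOn_indicator_iff hSm]
    set Kx : Set (EuclideanSpace ℝ (Fin 3)) := Prod.snd '' K with hKx
    have hKxc : IsCompact Kx := hK.image continuous_snd
    refine ((hcyl Kx hKxc).1).mono_set ?_
    rintro z ⟨hzS, hzK⟩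
    exact ⟨hzS.1, ⟨z, hzK, rfl⟩⟩
  have hus₀2 : LocallyIntegrable (fun z => ‖us₀ z‖ ^ 2) volume := by
    have e1 : (fun z => ‖us₀ z‖ ^ 2) = S.indicator (fun z => ‖uM z‖ ^ 2) := by
      funext z
      by_cases hz : z ∈ S
      · simp only [hus₀_def, indicator_of_mem hz]
      · simp only [hus₀_def, indicator_of_notMem hz, norm_zero]; norm_num
    rw [e1, locallyIntegrable_iff]
    intro K hK
    rw [integrableOn_indicator_iff hSm]
    set Kx : Set (EuclideanSpace ℝ (Fin 3)) := Prod.snd '' K with hKx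
    have hKxc : IsCompact Kx := hK.image continuous_snd
    refine ((hcyl Kx hKxc).2).mono_set ?_
    rintro z ⟨hzS, hzK⟩
    exact ⟨hzS.1, ⟨z, hzK, rfl⟩⟩
  have husi : LocallyIntegrable us volume := hus₀i.congr (hus_us₀.mono fun z hz => hz.symm)
  have hus2 : LocallyIntegrable (fun z => ‖us z‖ ^ 2) volume :=
    hus₀2.congr (hus_us₀.mono fun z hz => by simp only [hz])
  /- ## the modified gauged pressure -/
  set pt : ℝ × EuclideanSpace ℝ (Fin 3) → ℝ := fun z => p z.1 z.2 - cg z.1 with hpt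
  have hNae := hu.aestronglyMeasurable_localPressureNear x₀ (7 / 24 : ℝ)
  have hFae := hu.aestronglyMeasurable_localPressureFar x₀ (7 / 24 : ℝ)
  rw [← volume_restrict_slab_eq] at hNae hFae
  set nearM : ℝ × EuclideanSpace ℝ (Fin 3) → ℝ := hNae.mk _ with hnearM
  set farM : ℝ × EuclideanSpace ℝ (Fin 3) → ℝ := hFae.mk _ with hfarM
  have hnearMm : Measurable nearM := hNae.stronglyMeasurable_mk.measurable
  have hfarMm : Measurable farM := hFae.stronglyMeasurable_mk.measurable
  have hnearae : ∀ᵐ z ∂(volume : Measure (ℝ × EuclideanSpace ℝ (Fin 3))), z ∈ S' →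
      localPressureNear x₀ (7 / 24) u z.1 z.2 = nearM z := (ae_restrict_iff' hS'm).1 hNae.ae_eq_mk
  have hfarae : ∀ᵐ z ∂(volume : Measure (ℝ × EuclideanSpace ℝ (Fin 3))), z ∈ S' →
      localPressureFar x₀ (7 / 24) u z.1 z.2 = farM z := (ae_restrict_iff' hS'm).1 hFae.ae_eq_mk
  have hdecae : ∀ᵐ z ∂(volume : Measure (ℝ × EuclideanSpace ℝ (Fin 3))), z ∈ Ioo 0 T' ×ˢ ball x₀ (7 / 24) →
      p z.1 z.2 = localPressureNear x₀ (7 / 24) u z.1 z.2 + localPressureFar x₀ (7 / 24) u z.1 z.2 + cg z.1 :=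
    (ae_restrict_iff' (measurableSet_Ioo.prod measurableSet_ball)).1 hdec
  set pb : ℝ × EuclideanSpace ℝ (Fin 3) → ℝ := S.indicator fun z => nearM z + farM z with hpb
  have hpbm : Measurable pb := (hnearMm.add hfarMm).indicator hSm
  set ps : ℝ × EuclideanSpace ℝ (Fin 3) → ℝ := fun z =>
    if z.2 ∈ ball x₀ (7 / 24) then pb z else S.indicator pt z with hps_def
  have hps : ∀ᵐ z ∂(volume : Measure (ℝ × EuclideanSpace ℝ (Fin 3))), z ∈ S → ps z = (fun t x => p t x - cg t) z.1 z.2 := by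
    filter_upwards [hnearae, hfarae, hdecae] with z hzn hzf hzd hzS
    show ps z = p z.1 z.2 - cg z.1
    by_cases hzB : z.2 ∈ ball x₀ (7 / 24)
    · simp only [hps_def, hzB, if_true, hpb, indicator_of_mem hzS]
      rw [← hzn (hSS' hzS), ← hzf (hSS' hzS), hzd ⟨(hSS' hzS).1, hzB⟩]
      ring
    · simp only [hps_def, hzB, if_false, indicator_of_mem hzS, hpt]
  have hps0 : ∀ z, z ∉ S → ps z = 0 := fun z hz => by
    by_cases hzB : z.2 ∈ ball x₀ (7 / 24)
    · simp only [hps_def, hzB, if_true, hpb, indicator_of_notMem hz]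
    · simp only [hps_def, hzB, if_false, indicator_of_notMem hz]
  have hpspb : ∀ z : ℝ × EuclideanSpace ℝ (Fin 3), z.2 ∈ ball x₀ (7 / 24) → ps z = pb z := fun z hz => by
    simp only [hps_def, hz, if_true]
  have hpb0 : ∀ z, z ∉ S → pb z = 0 := fun z hz => indicator_of_notMem hz _
  -- integrability of the gauged pressure on finite cylinders
  have hptK : ∀ K : Set (EuclideanSpace ℝ (Fin 3)), IsCompact K → IntegrableOn pt (Ioo 0 Tb' ×ˢ K) volume := by
    intro K hK
    haveI : IsFiniteMeasure ((volume : Measure (ℝ × (EuclideanSpace ℝ (Fin 3)))).restrict (Ioo 0 Tb' ×ˢ K)) :=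
      ⟨by rw [Measure.restrict_apply_univ]; exact volume_Ioo_prod_lt_top hK⟩
    have hsub : Ioo 0 Tb' ×ˢ K ⊆ ((slab (EuclideanSpace ℝ (Fin 3)) (Ioo 0 Tb') isOpen_Ioo :
        Opens (ℝ × (EuclideanSpace ℝ (Fin 3)))) : Set (ℝ × (EuclideanSpace ℝ (Fin 3)))) :=
      fun z hz => mem_slab.2 hz.1
    have hp1 : IntegrableOn (uncurry p) (Ioo 0 Tb' ×ˢ K) volume := by
      have hm : AEStronglyMeasurable (uncurry p) ((volume : Measure (ℝ × (EuclideanSpace ℝ (Fin 3)))).restrict (Ioo 0 Tb' ×ˢ K)) :=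
        (hu''.suitable.distributional.2.2.1.mono_set hsub).aestronglyMeasurable
      exact BradshawTsai2019.integrable_of_lintegral_rpow_enorm_lt_top hm (by norm_num : (1 : ℝ) ≤ 3 / 2) (hu''.pressure K hK)
    have hc1 : IntegrableOn (fun z : ℝ × (EuclideanSpace ℝ (Fin 3)) => cg z.1) (Ioo 0 Tb' ×ˢ K) volume := by
      haveI : IsFiniteMeasure ((volume : Measure ℝ).restrict (Ioo 0 Tb')) := ⟨by
        rw [Measure.restrict_apply_univ]; exact measure_Ioo_lt_top⟩
      have h32 : (1 : ℝ≥0∞) ≤ 3 / 2 :=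
        ((ENNReal.lt_div_iff_mul_lt (Or.inl two_ne_zero) (Or.inl ENNReal.ofNat_ne_top)).2 (by norm_num)).le
      have hcT : MemLp cg (3 / 2 : ℝ≥0∞) (volume.restrict (Ioo 0 Tb')) :=
        hcg.mono_measure (Measure.restrict_mono (Ioo_subset_Ioo_right hTb'T') le_rfl)
      have hci : Integrable cg ((volume : Measure ℝ).restrict (Ioo 0 Tb')) := hcT.integrable h32
      haveI : IsFiniteMeasure ((volume : Measure (EuclideanSpace ℝ (Fin 3))).restrict K) :=
        ⟨by rw [Measure.restrict_apply_univ]; exact hK.measure_lt_top⟩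
      have h1 : Integrable (fun _ : EuclideanSpace ℝ (Fin 3) => (1 : ℝ)) ((volume : Measure (EuclideanSpace ℝ (Fin 3))).restrict K) :=
        integrable_const _
      have h := hci.mul_prod h1
      rw [IntegrableOn, Measure.volume_eq_prod, ← Measure.prod_restrict]
      simpa using h
    have h : IntegrableOn (fun z => uncurry p z - cg z.1) (Ioo 0 Tb' ×ˢ K) volume := hp1.sub hc1
    exact h
  have hpsi : LocallyIntegrable ps volume := by
    have hL : LocallyIntegrable (S.indicator pt) volume := by
      rw [locallyIntegrable_iff]
      intro K hK
      rw [integrableOn_indicator_iff hSm]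
      set Kx : Set (EuclideanSpace ℝ (Fin 3)) := Prod.snd '' K with hKx
      have hKxc : IsCompact Kx := hK.image continuous_snd
      refine (hptK Kx hKxc).mono_set ?_
      rintro z ⟨hzS, hzK⟩
      exact ⟨hzS.1, ⟨z, hzK, rfl⟩⟩
    refine hL.congr ?_
    filter_upwards [hps] with z hz
    by_cases hzS : z ∈ S
    · rw [indicator_of_mem hzS, hz hzS]
    · rw [indicator_of_notMem hzS, hps0 z hzS]
  /- ## the sizes of the pressure pieces -/
  -- near field: slice bound in `L²` for a.e. `t < T_b'`
  have hnear_slice : ∀ᵐ t ∂(volume.restrict (Ioo 0 Tb')), eLpNorm (fun x => nearM (t, x)) 2 volume ≤ Pn := by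
    have h1 : ∀ᵐ t ∂(volume.restrict (Ioo 0 T')), ∀ᵐ x ∂(volume : Measure (EuclideanSpace ℝ (Fin 3))),
        localPressureNear x₀ (7 / 24) u t x = nearM (t, x) := by
      have h := (ae_restrict_iff' hS'm).2 hnearae
      have h' := SerrinBoundedHolder.ae_ae_of_ae_restrict_prod (I := Ioo 0 T') (B := (univ : Set (EuclideanSpace ℝ (Fin 3)))) (P := fun z =>
        localPressureNear x₀ (7 / 24) u z.1 z.2 = nearM z) (h.mono fun z hz => hz)
      simpa only [Measure.restrict_univ] using h'
    have h2 := hu.ae_aestronglyMeasurable_slice'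
    have h3 : ∀ᵐ t ∂(volume.restrict (Ioo 0 Tb')), ∀ᵐ x ∂(volume : Measure (EuclideanSpace ℝ (Fin 3))),
        x ∈ ball x₀ (7 / 12) → ‖u t x‖ ≤ Kb := by
      have h := SerrinBoundedHolder.ae_ae_of_ae_restrict_prod hbd
      filter_upwards [h] with t ht
      exact (ae_restrict_iff' measurableSet_ball).1 ht
    have h1' := ae_restrict_of_ae_restrict_of_subset (Ioo_subset_Ioo_right hTb'T') h1
    have h2' := ae_restrict_of_ae_restrict_of_subset (Ioo_subset_Ioo_right hTb'T') h2
    filter_upwards [h1', h2', h3] with t ht1 ht2 ht3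
    have hb' : ∀ᵐ x ∂(volume : Measure (EuclideanSpace ℝ (Fin 3))), x ∈ ball x₀ (2 * (7 / 24)) → ‖u t x‖ ≤ Kb := by
      rw [show (2 : ℝ) * (7 / 24) = 7 / 12 by norm_num]; exact ht3
    have h := hCq hKb ht2 hb'
    rw [show (2 : ℝ) * (7 / 24) = 7 / 12 by norm_num, Measure.addHaar_ball_center] at h
    calc eLpNorm (fun x => nearM (t, x)) 2 volume = eLpNorm (localPressureNear x₀ (7 / 24) u t) 2 volume :=
          (eLpNorm_congr_ae (ht1.mono fun x hx => hx.symm))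
      _ ≤ _ := h
  -- far field: pointwise a.e. bound
  have hfar_ae : ∀ᵐ w ∂(volume : Measure (ℝ × EuclideanSpace ℝ (Fin 3))),
      w ∈ S' → w.2 ∈ ball x₀ (7 / 24) → ‖farM w‖ₑ ≤ Ffar * (αu : ℝ≥0∞) := by
    have ht : ∀ᵐ t ∂(volume : Measure ℝ), t ∈ Ioo 0 T' → AEStronglyMeasurable (u t) volume ∧
        ∀ z : EuclideanSpace ℝ (Fin 3), ∫⁻ x in ball z 1, ‖u t x‖ₑ ^ 2 ≤ αu := by
      have h := hu.ae_aestronglyMeasurable_slice'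
      rw [← ae_restrict_iff' measurableSet_Ioo]
      filter_upwards [h, hαu] with t h1 h2
      exact ⟨h1, h2⟩
    have hprod : ∀ᵐ w ∂(volume : Measure (ℝ × EuclideanSpace ℝ (Fin 3))), w.1 ∈ Ioo 0 T' →
        AEStronglyMeasurable (u w.1) volume ∧ ∀ z : EuclideanSpace ℝ (Fin 3), ∫⁻ x in ball z 1, ‖u w.1 x‖ₑ ^ 2 ≤ αu := by
      have hq : Measure.QuasiMeasurePreserving (Prod.fst : ℝ × EuclideanSpace ℝ (Fin 3) → ℝ) volume volume := by
        rw [Measure.volume_eq_prod]; exact Measure.quasiMeasurePreserving_fst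
      exact hq.ae ht
    filter_upwards [hprod, hfarae] with w hw hwf hwS' hwB
    obtain ⟨hm, hα⟩ := hw hwS'.1
    rw [← hwf hwS']
    exact hFfar hm hα w.2 hwB
  -- the `L¹` bound on the cylinder `(0,T_b') × B(x₀, 7/24)`
  have hcylm : MeasurableSet (Ioo 0 Tb' ×ˢ ball x₀ (7 / 24)) := measurableSet_Ioo.prod measurableSet_ball
  have hlin : ∫⁻ z in Ioo 0 Tb' ×ˢ ball x₀ (7 / 24), ‖pb z‖ₑ ≤ PpE := by
    -- pointwise: `|pb| ≤ |nearM| + Ffar αu` a.e. on the cylinder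
    have hpt' : ∀ᵐ z ∂(volume.restrict (Ioo 0 Tb' ×ˢ ball x₀ (7 / 24))),
        ‖pb z‖ₑ ≤ ‖nearM z‖ₑ + Ffar * (αu : ℝ≥0∞) := by
      rw [ae_restrict_iff' hcylm]
      filter_upwards [hfar_ae] with z hz hzC
      have hzS : z ∈ S := ⟨hzC.1, mem_univ _⟩
      simp only [hpb, indicator_of_mem hzS]
      exact (enorm_add_le _ _).trans (add_le_add le_rfl (hz (hSS' hzS) hzC.2))
    calc ∫⁻ z in Ioo 0 Tb' ×ˢ ball x₀ (7 / 24), ‖pb z‖ₑ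
        ≤ ∫⁻ z in Ioo 0 Tb' ×ˢ ball x₀ (7 / 24), (‖nearM z‖ₑ + Ffar * (αu : ℝ≥0∞)) := lintegral_mono_ae hpt'
      _ = (∫⁻ z in Ioo 0 Tb' ×ˢ ball x₀ (7 / 24), ‖nearM z‖ₑ) +
            Ffar * (αu : ℝ≥0∞) * volume (Ioo 0 Tb' ×ˢ ball x₀ (7 / 24)) := by
          rw [lintegral_add_left hnearMm.enorm, lintegral_const, Measure.restrict_apply_univ]
      _ ≤ Pn * Vρ ^ (1 - 1 / (2 : ℝ≥0∞).toReal) + Ffar * (αu : ℝ≥0∞) * Vρ := by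
          refine add_le_add ?_ ?_
          · -- Tonelli and the slice bound
            rw [Measure.volume_eq_prod, ← Measure.prod_restrict, lintegral_prod _ hnearMm.enorm.aemeasurable]
            have hsl : ∀ᵐ t ∂(volume.restrict (Ioo 0 Tb')),
                ∫⁻ x in ball x₀ (7 / 24), ‖nearM (t, x)‖ₑ ≤ Pn * Vρ ^ (1 - 1 / (2 : ℝ≥0∞).toReal) := by
              filter_upwards [hnear_slice] with t ht
              have hmt : AEStronglyMeasurable (fun x => nearM (t, x)) (volume : Measure (EuclideanSpace ℝ (Fin 3))) :=
                (hnearMm.comp measurable_prodMk_left).aestronglyMeasurable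
              have h := setLIntegral_enorm_le_eLpNorm_mul_measure_rpow (μ := (volume : Measure (EuclideanSpace ℝ (Fin 3))))
                hmt (q := 2) (by norm_num) (ball x₀ (7 / 24))
              have hV : (volume : Measure (EuclideanSpace ℝ (Fin 3))) (ball x₀ (7 / 24)) = Vρ := by
                rw [hVρ, Measure.addHaar_ball_center]
              rw [hV] at h
              exact h.trans (mul_le_mul' ht le_rfl)
            calc ∫⁻ t in Ioo 0 Tb', ∫⁻ x in ball x₀ (7 / 24), ‖nearM (t, x)‖ₑ
                ≤ ∫⁻ _t in Ioo 0 Tb', Pn * Vρ ^ (1 - 1 / (2 : ℝ≥0∞).toReal) := lintegral_mono_ae hsl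
              _ = Pn * Vρ ^ (1 - 1 / (2 : ℝ≥0∞).toReal) * volume (Ioo (0 : ℝ) Tb') := by
                  rw [lintegral_const, Measure.restrict_apply_univ]
              _ ≤ Pn * Vρ ^ (1 - 1 / (2 : ℝ≥0∞).toReal) * 1 := by
                  refine mul_le_mul' le_rfl ?_
                  rw [Real.volume_Ioo, sub_zero]; exact ENNReal.ofReal_le_one.2 hTb1
              _ = _ := mul_one _
          · refine mul_le_mul' le_rfl ?_
            rw [Measure.volume_eq_prod, Measure.prod_prod, Measure.addHaar_ball_center, Real.volume_Ioo, sub_zero]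
            calc ENNReal.ofReal Tb' * Vρ ≤ 1 * Vρ := mul_le_mul' (ENNReal.ofReal_le_one.2 hTb1) le_rfl
              _ = Vρ := one_mul _
  have hpbI : IntegrableOn pb (Ioo 0 Tb' ×ˢ ball x₀ (7 / 24)) volume :=
    ⟨hpbm.aestronglyMeasurable, (hasFiniteIntegral_iff_enorm.2 (hlin.trans_lt (lt_top_iff_ne_top.2 hPpEt)))⟩
  have hpbPp : ∫ z in Ioo 0 Tb' ×ˢ ball x₀ (7 / 24), ‖pb z‖ ≤ PpE.toReal := by
    rw [integral_norm_eq_lintegral_enorm hpbI.aestronglyMeasurable]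
    exact ENNReal.toReal_mono hPpEt hlin
  /- ## the representation for a cut-off `χ` and a direction `c` -/
  refine ⟨us, ps, pb, husm, hpbm, hus, hus0, husb, husi, hus2, hps0, hpsi, hpspb, hpb0, hpbI, hpbPp, ?_⟩
  intro χ hχs hχsupp c
  have hχ2 : ContDiff ℝ 2 χ := hχs.of_le (by norm_cast)
  have hχzero : ∀ y, y ∉ closedBall x₀ (7 / 25) → χ y = 0 := fun y hy =>
    image_eq_zero_of_notMem_tsupport fun h => hy (hχsupp h)
  have hχfzero : ∀ y, y ∉ closedBall x₀ (7 / 25) → fderiv ℝ χ y = 0 := fun y hy => by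
    have h0 : χ =ᶠ[𝓝 y] fun _ => (0 : ℝ) := notMem_tsupport_iff_eventuallyEq.1 fun h => hy (hχsupp h)
    rw [h0.fderiv_eq, fderiv_fun_const]; rfl
  have hχcs : HasCompactSupport χ := HasCompactSupport.of_support_subset_isCompact (isCompact_closedBall x₀ (7 / 25))
    ((subset_tsupport χ).trans hχsupp)
  obtain ⟨Mχ, hMχ⟩ := hχs.continuous.bounded_above_of_compact_support hχcs
  /- ### the time plateau and the space–time cut-off -/
  set δ : ℝ := (Tb' - Tb) / 8 with hδ
  have hδ0 : 0 < δ := by rw [hδ]; linarith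
  set ζ : ℝ → ℝ := fun t => timePlateau δ (Tb + 6 * δ) (t + 2 * δ) with hζ
  have hζ1 : ∀ t, 0 ≤ t → t ≤ Tb + 2 * δ → ζ t = 1 := fun t h0 h1 =>
    timePlateau_eq_one hδ0 (by linarith) (by linarith)
  have hζhi : ∀ t, Tb + 3 * δ ≤ t → ζ t = 0 := fun t ht => timePlateau_eq_zero_of_ge hδ0 (by linarith)
  have hζlo : ∀ t, t ≤ -δ → ζ t = 0 := fun t ht => timePlateau_eq_zero_of_le hδ0 (by linarith)
  have hζle : ∀ t, ζ t ≤ 1 := fun t => timePlateau_le_one _ _ _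
  have hζs : ContDiff ℝ (⊤ : ℕ∞) ζ := (contDiff_timePlateau δ (Tb + 6 * δ)).comp (contDiff_id.add contDiff_const)
  have hζd : ∀ t, 0 ≤ t → t ≤ Tb → deriv ζ t = 0 := fun t h0 h1 =>
    IsLocalMax.deriv_eq_zero (Eventually.of_forall fun s => by
      rw [hζ1 t h0 (by linarith)]; exact hζle s)
  set φ : ℝ → (EuclideanSpace ℝ (Fin 3)) → ℝ := fun t x => ζ t * χ x with hφ
  set Kφ : Set (ℝ × EuclideanSpace ℝ (Fin 3)) := Icc (-δ) (Tb + 3 * δ) ×ˢ closedBall x₀ (7 / 25) with hKφ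
  have hKφc : IsCompact Kφ := isCompact_Icc.prod (isCompact_closedBall _ _)
  have hφzero : ∀ z : ℝ × EuclideanSpace ℝ (Fin 3), z ∉ Kφ → uncurry φ z = 0 := by
    rintro ⟨t, x⟩ hz
    simp only [uncurry, hφ]
    by_cases hx : x ∈ closedBall x₀ (7 / 25)
    · have ht : t ∉ Icc (-δ) (Tb + 3 * δ) := fun h => hz ⟨h, hx⟩
      rw [mem_Icc, not_and_or, not_le, not_le] at ht
      rcases ht with h | h
      · rw [hζlo t h.le, zero_mul]
      · rw [hζhi t h.le, zero_mul]
    · rw [hχzero x hx, mul_zero]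
  have hφcs : HasCompactSupport (uncurry φ) := HasCompactSupport.intro hKφc hφzero
  have hφtsupp : tsupport (uncurry φ) ⊆ Kφ :=
    closure_minimal (fun z hz => by by_contra h; exact hz (hφzero z h)) (hKφc.isClosed)
  have hφT : IsSpaceTimeTestOn (slab (EuclideanSpace ℝ (Fin 3)) (Iio Tb') isOpen_Iio) φ := by
    refine ⟨?_, hφcs, fun z hz => mem_slab.2 ?_⟩
    · have : uncurry φ = fun z : ℝ × EuclideanSpace ℝ (Fin 3) => ζ z.1 * χ z.2 := rfl
      rw [this]
      exact (hζs.comp contDiff_fst).mul (hχs.comp contDiff_snd)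
    · have h := (hφtsupp hz).1
      rw [mem_Iio]; rw [mem_Icc] at h; linarith [h.2]
  have hφ0 : ∀ x, φ 0 x = χ x := fun x => by simp only [hφ, hζ1 0 le_rfl (by positivity), one_mul]
  -- derivative formulas
  have hφfd : ∀ (t : ℝ) (x v : EuclideanSpace ℝ (Fin 3)), fderiv ℝ (φ t) x v = ζ t * fderiv ℝ χ x v := by
    intro t x v
    have hdχ : DifferentiableAt ℝ χ x := (hχs.differentiable (by simp)) x
    have e1 : (φ t) = fun y => ζ t * χ y := rfl
    rw [e1, fderiv_const_mul hdχ]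
    rfl
  have hφΔ : ∀ (t : ℝ) (x : EuclideanSpace ℝ (Fin 3)), (Δ (φ t)) x = ζ t * (Δ χ) x := by
    intro t x
    have e1 : (φ t) = fun y => ζ t • χ y := by funext y; simp only [hφ, smul_eq_mul]
    rw [e1, laplacian_fun_const_smul hχ2 (ζ t) x, smul_eq_mul]
  have hφdt : ∀ (t : ℝ) (x : EuclideanSpace ℝ (Fin 3)), timeDeriv φ t x = deriv ζ t * χ x := by
    intro t x
    rw [timeDeriv_apply]
    show deriv (fun s => ζ s * χ x) t = deriv ζ t * χ x
    exact deriv_mul_const_field _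
  -- the datum bound
  obtain ⟨M₀, hM₀⟩ : ∃ M₀ : ℝ, ∀ x, ‖φ 0 x • u₀ x‖ ≤ M₀ := by
    refine ⟨Mχ * max M 0, fun x => ?_⟩
    rw [hφ0, norm_smul]
    by_cases hx : x ∈ closedBall x₀ (7 / 25)
    · exact mul_le_mul (hMχ x) ((hu₀M x hx).trans (le_max_left _ _)) (norm_nonneg _)
        ((norm_nonneg _).trans (hMχ x))
    · rw [hχzero x hx, norm_zero, zero_mul]; exact mul_nonneg ((norm_nonneg _).trans (hMχ x)) (le_max_right _ _)
  /- ### the representation and its truncation in time -/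
  have repr := duhamel_representation_datum (p := fun t x => p t x - cg t) hus hus0 husi hus2 hps hps0 hpsi hweak hm₀
    hφT hM₀ c
  simp only [← hb_def] at repr
  have hsubT : Ioo 0 Tb ×ˢ (univ : Set (EuclideanSpace ℝ (Fin 3))) ⊆ S := Set.prod_mono (Ioo_subset_Ioo_right hTbTb'.le) Subset.rfl
  have repr' := ae_restrict_of_ae_restrict_of_subset hsubT repr
  filter_upwards [repr', ae_restrict_mem (measurableSet_Ioo.prod MeasurableSet.univ)] with z hz hzS
  have hz0 : 0 < z.1 := hzS.1.1
  have hzT : z.1 < Tb := hzS.1.2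
  have hφz : φ z.1 z.2 = χ z.2 := by simp only [hφ, hζ1 z.1 hz0.le (by linarith), one_mul]
  rw [hφz] at hz
  rw [hz]
  -- agreement of the data below `T_b`
  have hζw : ∀ w : ℝ × EuclideanSpace ℝ (Fin 3), w ∈ S → w.1 < Tb → ζ w.1 = 1 := fun w hw hwT =>
    hζ1 w.1 hw.1.1.le (by linarith)
  have hcb : closedBall x₀ (7 / 25) ⊆ ball x₀ (7 / 24) := closedBall_subset_ball (by norm_num)
  have A1 : ∀ w : ℝ × EuclideanSpace ℝ (Fin 3), w.1 < Tb →
      (timeDeriv φ w.1 w.2 + (Δ (φ w.1)) w.2) * ⟪us w, c⟫ = (if w.1 < Tb then (Δ χ) w.2 * ⟪us w, c⟫ else 0) := by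
    intro w hw
    rw [if_pos hw]
    by_cases hwS : w ∈ S
    · rw [hφdt, hφΔ, hζd w.1 hwS.1.1.le hw.le, hζw w hwS hw]; ring
    · simp only [hus0 w hwS, inner_zero_left, mul_zero]
  have A2 : ∀ i (w : ℝ × EuclideanSpace ℝ (Fin 3)), w.1 < Tb →
      (2 * fderiv ℝ (φ w.1) w.2 (b i)) * ⟪us w, c⟫ = (if w.1 < Tb then (2 * fderiv ℝ χ w.2 (b i)) * ⟪us w, c⟫ else 0) := by
    intro i w hw
    rw [if_pos hw]
    by_cases hwS : w ∈ S
    · rw [hφfd, hζw w hwS hw]; ring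
    · simp only [hus0 w hwS, inner_zero_left, mul_zero]
  have A3 : ∀ i (w : ℝ × EuclideanSpace ℝ (Fin 3)), w.1 < Tb →
      fderiv ℝ (φ w.1) w.2 (b i) * (⟪us w, b i⟫ * ⟪us w, c⟫) =
        (if w.1 < Tb then fderiv ℝ χ w.2 (b i) * (⟪us w, b i⟫ * ⟪us w, c⟫) else 0) := by
    intro i w hw
    rw [if_pos hw]
    by_cases hwS : w ∈ S
    · rw [hφfd, hζw w hwS hw]; ring
    · simp only [hus0 w hwS, inner_zero_left, mul_zero]
  have A4 : ∀ i (w : ℝ × EuclideanSpace ℝ (Fin 3)), w.1 < Tb →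
      φ w.1 w.2 * (⟪us w, b i⟫ * ⟪us w, c⟫) = (if w.1 < Tb then χ w.2 * (⟪us w, b i⟫ * ⟪us w, c⟫) else 0) := by
    intro i w hw
    rw [if_pos hw]
    by_cases hwS : w ∈ S
    · simp only [hφ, hζw w hwS hw, one_mul]
    · simp only [hus0 w hwS, inner_zero_left, mul_zero]
  have A5 : ∀ w : ℝ × EuclideanSpace ℝ (Fin 3), w.1 < Tb →
      fderiv ℝ (φ w.1) w.2 c * ps w = (if w.1 < Tb then fderiv ℝ χ w.2 c * pb w else 0) := by
    intro w hw
    rw [if_pos hw, hφfd]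
    by_cases hwx : w.2 ∈ closedBall x₀ (7 / 25)
    · rw [hpspb w (hcb hwx)]
      by_cases hwS : w ∈ S
      · rw [hζw w hwS hw]; ring
      · rw [hpb0 w hwS, mul_zero, mul_zero]
    · have hfd0 : fderiv ℝ χ w.2 c = 0 := by rw [hχfzero _ hwx]; rfl
      rw [hfd0, mul_zero, zero_mul, zero_mul]
  have A6 : ∀ w : ℝ × EuclideanSpace ℝ (Fin 3), w.1 < Tb → φ w.1 w.2 * ps w = (if w.1 < Tb then χ w.2 * pb w else 0) := by
    intro w hw
    rw [if_pos hw]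
    by_cases hwx : w.2 ∈ closedBall x₀ (7 / 25)
    · rw [hpspb w (hcb hwx)]
      by_cases hwS : w ∈ S
      · simp only [hφ, hζw w hwS hw, one_mul]
      · rw [hpb0 w hwS, mul_zero, mul_zero]
    · have : φ w.1 w.2 = 0 := by simp only [hφ, hχzero _ hwx, mul_zero]
      rw [this, zero_mul, hχzero _ hwx, zero_mul]
  have A2' : ∀ i, multiplierHeatPotential 1 (derivSymbol (b i))
      (fun w : ℝ × EuclideanSpace ℝ (Fin 3) => (2 * fderiv ℝ (φ w.1) w.2 (b i)) * ⟪us w, c⟫) z =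
      multiplierHeatPotential 1 (derivSymbol (b i))
        (fun w : ℝ × EuclideanSpace ℝ (Fin 3) => if w.1 < Tb then (2 * fderiv ℝ χ w.2 (b i)) * ⟪us w, c⟫ else 0) z :=
    fun i => multiplierHeatPotential_congr_of_lt (A2 i) hzT.le
  have A3' : ∀ i, heatPotential 1 (fun w : ℝ × EuclideanSpace ℝ (Fin 3) =>
      fderiv ℝ (φ w.1) w.2 (b i) * (⟪us w, b i⟫ * ⟪us w, c⟫)) z =
      heatPotential 1 (fun w : ℝ × EuclideanSpace ℝ (Fin 3) =>
        if w.1 < Tb then fderiv ℝ χ w.2 (b i) * (⟪us w, b i⟫ * ⟪us w, c⟫) else 0) z := fun i =>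
    heatPotential_congr_of_lt (A3 i) hzT.le
  have A4' : ∀ i, multiplierHeatPotential 1 (derivSymbol (b i))
      (fun w : ℝ × EuclideanSpace ℝ (Fin 3) => φ w.1 w.2 * (⟪us w, b i⟫ * ⟪us w, c⟫)) z =
      multiplierHeatPotential 1 (derivSymbol (b i))
        (fun w : ℝ × EuclideanSpace ℝ (Fin 3) => if w.1 < Tb then χ w.2 * (⟪us w, b i⟫ * ⟪us w, c⟫) else 0) z :=
    fun i => multiplierHeatPotential_congr_of_lt (A4 i) hzT.le
  have A7 : (fun y => φ 0 y * ⟪u₀ y, c⟫) = fun y => χ y * ⟪u₀ y, c⟫ := by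
    funext y; rw [hφ0]
  rw [heatPotential_congr_of_lt A1 hzT.le, heatPotential_congr_of_lt A5 hzT.le, multiplierHeatPotential_congr_of_lt A6 hzT.le]
  simp only [A2', A3', A4', hz0, if_true, A7]

end JiaSverak2014

end Literature.Analysis.FluidPDE
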